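import Summits.AnomalousDissipation.AnomalousDissipation.Theorems.SawtoothPulseCascadeK1LocalisedCascadeFinalGlue
import Literature.Analysis.FluidPDE.SawtoothCascade

/-!
# K1loc, line `Spectral` / SeqCone — helper: THE TRACKED-SYMBOL LEDGER ⇒ THE STUB'S CONCLUSION (S-C assembly, endgame)

Helper file of the prover lane on the crux `K1LocalisedCascade` (stmt-AnomalousDissipation-19491), route
`SawtoothPulseCascade` (memo v6 §4 S-C "Bookkeeping"; addendum rev 2 §B).  The half-slot machine of the helper files
(`…FamilyStep`, `…InputSplit`, `…FamilySplit`, `…SlotExpansionTwoBranch`, zone terms) delivers, for the TRUE classical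
cascade scalar `w` and a family of tracked symbols `μᴴ_j` (start of phase `j`) / `μⱽ_j` (mid phase `j`), per-half-slot
inequalities in ENERGY form
  `‖μⱽ_j(D) w(tStart j + tHalf j)‖² ≤ (‖μᴴ_j(D) w(tStart j)‖ + εᴴ_j)² + ζᴴ_j`,
  `‖μᴴ_{j+1}(D) w(tStart (j+1))‖² ≤ (‖μⱽ_j(D) w(tStart j + tHalf j)‖ + εⱽ_j)² + ζⱽ_j`
(`ε` = commutator/slot-lemma amplitudes, `ζ` = cross-term and zone ENERGIES), where
`‖μ(D)f‖ = √(Σ_k μ(k)²|𝓕f(k)|²)`.  This file is the bookkeeping that turns such a ledger into the registered stub's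
conclusion:
* §1 `le_add_sqrt_add_of_sq_le` / `chain_le` — the energy-form recursion `a_{s+1}² ≤ (a_s + ε_s)² + ζ_s` sums as
  `a_n ≤ a_m + Σ ε_s + √(Σ ζ_s)` (amplitudes add, energies add under ONE square root — the point of the energy form);
* §2 `phase_chain_le` — the same over phases (H then V half-slot);
* §3 `lowModeEnergy_le_of_symbol` — a tracked symbol with `μ² ≥ 1` on the low block `|k_i| < K` dominates the low-block energy;
* §4 **`highModeConcentration_of_ledger`** — for ANY cascade parameters `P`, rate `r`, datum `θ₀ ≠ 0`: a symbol family whose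
  start-of-phase symbols are `≥ 1` on `|k₀| < c·ρ^J` (`J ≥ i₀`), a lag `A ≥ i₀` passing the slot-damping threshold
  (`…K1Lag.exists_lag`), per-half-slot ledger inequalities for `i₀ ≤ j < J_r(κ) + A` with `κ`-uniformly summable `ε, ζ`, and a
  start bound `‖μᴴ_{i₀}(D) w(tStart i₀)‖ ≤ q₀` (the first good piece, S-D) with `q₀ + Σε + √Σζ < ‖θ₀‖` give EXACTLY the body of
  `stub_highModeConcentration` (there: `P = ⟨γ,¼,2,1,ρN⟩`, `r = γ²−3`, `θ₀ = datum`): `∃ χ>0 ∃ A ∃ κ₀>0 ∀ κ ≤ κ₀ ∀ w, ∃ K ≥ 0,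
  1 ≤ 8π²κK²·tHalf J ∧ ofReal(2χ‖θ₀‖²) ≤ highModeEnergy 0 K (w(tStart J)) + 2·eScalarDissipation κ w 0 (tStart J)`,
  `J = J_r(κ) + A` (via `…FinalGlue.stub_form_of_lowModeEnergy_le`);
* §5 a tool for the dischargers: `mul_pow_lt_pow_of_lt_Jrate_add` — `κ·r^{2j} < r^{2A}` for `j < J_r(κ) + A`,
  `0 < κ ≤ 1` (the `κ`-uniform majorisation of per-phase errors on the phases the ledger runs over).  The lag `A ≥ i₀`
  itself comes from `…K1Lag.exists_lag` (companion file `…K1LocalisedCascadeLagGe`, kept apart so that this file does not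
  import the route file).
So the stub is reduced to three named inputs with fixed interfaces: the symbol family (S-B: `…SymbolCone`), the per-half-slot
ledger inequality (S-A∘S-B + zone/cross energies), the first good piece (S-D).  WHAT THIS IS NOT: no statement about those
three inputs; no definitions; nothing about the stub itself is claimed.
[cite: DEIJ2022, (1.2)–(1.3) (κ-uniform dissipated fraction)] [cite: Grafakos2014, Prop. 3.2.7 (3) (Parseval)] [problem: turb]
-/

-- `Summit.<Summit>.<Problem>`: single-conjunct summit, the duplicate namespace segment is deliberate.
set_option linter.dupNamespace false

noncomputable section

namespace Summit.AnomalousDissipation.AnomalousDissipation.Theorems.SawtoothPulseCascade.K1Ledger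

open MeasureTheory Set Filter Topology UnitAddTorus Function
open scoped ENNReal
open Literature.Analysis Literature.Analysis.FunctionSpaces Literature.Analysis.FunctionSpaces.Torus
open Literature.Analysis.FluidPDE.Torus (highModeEnergy)
open Literature.Analysis.FluidPDE.SawtoothCascade Literature.Analysis.FluidPDE.SawtoothCascade.CascadeParams
open Summit.AnomalousDissipation.AnomalousDissipation.Theorems.SawtoothPulseCascade.SpectralLeakage
open Summit.AnomalousDissipation.AnomalousDissipation.Theorems.SawtoothPulseCascade.K1Slot

/-! ## §1 The energy-form recursion -/

/-- **One ledger step.**  If `0 ≤ x ≤ α + √Z` and `y² ≤ (x + ε)² + ζ` with `y, α, Z, ε, ζ ≥ 0`, then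
`y ≤ α + ε + √(Z + ζ)`: the amplitude error adds, the energy error joins the earlier energies under one root
(`(α+ε+√Z)² + ζ ≤ (α+ε+√(Z+ζ))²` since `√(Z+ζ) − √Z ≥ 0`). [folklore] -/
theorem le_add_sqrt_add_of_sq_le {x y α Z ε ζ : ℝ} (hx : 0 ≤ x) (hy : 0 ≤ y) (hα : 0 ≤ α) (hZ : 0 ≤ Z)
    (hε : 0 ≤ ε) (hζ : 0 ≤ ζ) (hxle : x ≤ α + Real.sqrt Z) (hstep : y ^ 2 ≤ (x + ε) ^ 2 + ζ) :
    y ≤ α + ε + Real.sqrt (Z + ζ) := by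
  have hsZ : 0 ≤ Real.sqrt Z := Real.sqrt_nonneg _
  have hsZζ : Real.sqrt Z ≤ Real.sqrt (Z + ζ) := Real.sqrt_le_sqrt (by linarith)
  have hB : 0 ≤ α + ε + Real.sqrt (Z + ζ) := by positivity
  -- `(x+ε)² ≤ (α + ε + √Z)²`
  have h1 : (x + ε) ^ 2 ≤ (α + ε + Real.sqrt Z) ^ 2 :=
    pow_le_pow_left₀ (by positivity) (by linarith) 2
  -- `(α+ε+√Z)² + ζ ≤ (α+ε+√(Z+ζ))²`
  have h2 : (α + ε + Real.sqrt Z) ^ 2 + ζ ≤ (α + ε + Real.sqrt (Z + ζ)) ^ 2 := by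
    have hZ2 : Real.sqrt Z ^ 2 = Z := Real.sq_sqrt hZ
    have hZζ2 : Real.sqrt (Z + ζ) ^ 2 = Z + ζ := Real.sq_sqrt (by linarith)
    nlinarith [hsZζ, hsZ]
  have h3 : y ^ 2 ≤ (α + ε + Real.sqrt (Z + ζ)) ^ 2 := by linarith
  exact (pow_le_pow_iff_left₀ hy hB (by norm_num : (2 : ℕ) ≠ 0)).1 h3

/-- **The ledger sums** (half-slot indexing): for non-negative `a, ε, ζ` with `a_{s+1}² ≤ (a_s + ε_s)² + ζ_s` for
`m ≤ s < n`, `a_n ≤ a_m + Σ_{s∈[m,n)} ε_s + √(Σ_{s∈[m,n)} ζ_s)`. [folklore] -/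
theorem chain_le {a ε ζ : ℕ → ℝ} (ha : ∀ s, 0 ≤ a s) (hε : ∀ s, 0 ≤ ε s) (hζ : ∀ s, 0 ≤ ζ s) (m : ℕ) :
    ∀ n, m ≤ n → (∀ s, m ≤ s → s < n → a (s + 1) ^ 2 ≤ (a s + ε s) ^ 2 + ζ s) →
      a n ≤ a m + ∑ s ∈ Finset.Ico m n, ε s + Real.sqrt (∑ s ∈ Finset.Ico m n, ζ s) := by
  refine Nat.le_induction ?_ ?_
  · intro _
    simp
  · intro n hmn ih hstep
    have ih' := ih fun s hs hsn => hstep s hs (Nat.lt_succ_of_lt hsn)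
    have hn := hstep n hmn (Nat.lt_succ_self n)
    rw [Finset.sum_Ico_succ_top hmn, Finset.sum_Ico_succ_top hmn, ← add_assoc]
    exact le_add_sqrt_add_of_sq_le (ha n) (ha (n + 1)) (add_nonneg (ha m) (Finset.sum_nonneg fun s _ => hε s))
      (Finset.sum_nonneg fun s _ => hζ s) (hε n) (hζ n) ih' hn

/-! ## §2 The ledger over phases (H half-slot, then V half-slot) -/

/-- **The ledger sums, phase indexing.**  Non-negative `Qᴴ, Qⱽ, εᴴ, εⱽ, ζᴴ, ζⱽ` with, for `i₀ ≤ j < J`,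
`(Qⱽ_j)² ≤ (Qᴴ_j + εᴴ_j)² + ζᴴ_j` (H half-slot) and `(Qᴴ_{j+1})² ≤ (Qⱽ_j + εⱽ_j)² + ζⱽ_j` (V half-slot) satisfy
`Qᴴ_J ≤ Qᴴ_{i₀} + Σ_{j∈[i₀,J)} (εᴴ_j + εⱽ_j) + √(Σ_{j∈[i₀,J)} (ζᴴ_j + ζⱽ_j))`. [folklore] -/
theorem phase_chain_le {QH QV εH εV ζH ζV : ℕ → ℝ} (hQH : ∀ j, 0 ≤ QH j) (hQV : ∀ j, 0 ≤ QV j)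
    (hεH : ∀ j, 0 ≤ εH j) (hεV : ∀ j, 0 ≤ εV j) (hζH : ∀ j, 0 ≤ ζH j) (hζV : ∀ j, 0 ≤ ζV j) (i₀ : ℕ) :
    ∀ J, i₀ ≤ J →
      (∀ j, i₀ ≤ j → j < J → QV j ^ 2 ≤ (QH j + εH j) ^ 2 + ζH j) →
      (∀ j, i₀ ≤ j → j < J → QH (j + 1) ^ 2 ≤ (QV j + εV j) ^ 2 + ζV j) →
        QH J ≤ QH i₀ + ∑ j ∈ Finset.Ico i₀ J, (εH j + εV j) + Real.sqrt (∑ j ∈ Finset.Ico i₀ J, (ζH j + ζV j)) := by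
  refine Nat.le_induction ?_ ?_
  · intro _ _
    simp
  · intro n hn ih hH hV
    have ih' := ih (fun j hj hjn => hH j hj (Nat.lt_succ_of_lt hjn)) fun j hj hjn => hV j hj (Nat.lt_succ_of_lt hjn)
    have hHn := hH n hn (Nat.lt_succ_self n)
    have hVn := hV n hn (Nat.lt_succ_self n)
    set α : ℝ := QH i₀ + ∑ j ∈ Finset.Ico i₀ n, (εH j + εV j) with hα
    set Z : ℝ := ∑ j ∈ Finset.Ico i₀ n, (ζH j + ζV j) with hZ
    have hα0 : 0 ≤ α := add_nonneg (hQH i₀) (Finset.sum_nonneg fun j _ => add_nonneg (hεH j) (hεV j))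
    have hZ0 : 0 ≤ Z := Finset.sum_nonneg fun j _ => add_nonneg (hζH j) (hζV j)
    -- H half-slot of phase `n`
    have h1 : QV n ≤ α + εH n + Real.sqrt (Z + ζH n) :=
      le_add_sqrt_add_of_sq_le (hQH n) (hQV n) hα0 hZ0 (hεH n) (hζH n) ih' hHn
    -- V half-slot of phase `n`
    have h2 : QH (n + 1) ≤ (α + εH n) + εV n + Real.sqrt ((Z + ζH n) + ζV n) :=
      le_add_sqrt_add_of_sq_le (hQV n) (hQH (n + 1)) (add_nonneg hα0 (hεH n)) (add_nonneg hZ0 (hζH n))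
        (hεV n) (hζV n) h1 hVn
    rw [Finset.sum_Ico_succ_top hn, Finset.sum_Ico_succ_top hn]
    calc QH (n + 1) ≤ (α + εH n) + εV n + Real.sqrt ((Z + ζH n) + ζV n) := h2
      _ = QH i₀ + (∑ j ∈ Finset.Ico i₀ n, (εH j + εV j) + (εH n + εV n)) +
            Real.sqrt (∑ j ∈ Finset.Ico i₀ n, (ζH j + ζV j) + (ζH n + ζV n)) := by
          rw [hα, hZ]; ring_nf

/-! ## §3 A tracked symbol dominates the low block -/

section LowBlock

variable {d : Type*} [Fintype d]

/-- **Low-block domination.**  For continuous real `θ` on `T^d` and a bounded real symbol `μ` with `μ² ≥ 1` on the low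
block `|k_i| < K`: `Σ_{|k_i|<K} |𝓕θ(k)|² ≤ Σ_k μ(k)²|𝓕θ(k)|²`. [cite: Grafakos2014, Prop. 3.2.7 (3)] -/
theorem lowModeEnergy_le_of_symbol {θ : UnitAddTorus d → ℝ} (hθ : Continuous θ) (i : d) (K : ℝ)
    {μ : (d → ℤ) → ℝ} {M : ℝ} (hμM : ∀ k, |μ k| ≤ M) (hlow : ∀ k : d → ℤ, |((k i : ℤ) : ℝ)| < K → 1 ≤ μ k ^ 2) :
    ∑' k, (if |((k i : ℤ) : ℝ)| < K then (1 : ℝ) else 0) * ‖mFourierCoeff (fun x => (θ x : ℂ)) k‖ ^ 2 ≤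
      ∑' k, μ k ^ 2 * ‖mFourierCoeff (fun x => (θ x : ℂ)) k‖ ^ 2 := by
  classical
  have hM0 : 0 ≤ M := (abs_nonneg _).trans (hμM 0)
  have hμ2 : ∀ k, μ k ^ 2 ≤ M ^ 2 := fun k => by
    rw [← sq_abs]; exact pow_le_pow_left₀ (abs_nonneg _) (hμM k) 2
  have hP := hasSum_sq_norm_mFourierCoeff_scalarL2Sq hθ
  have hsμ : Summable fun k => μ k ^ 2 * ‖mFourierCoeff (fun x => (θ x : ℂ)) k‖ ^ 2 :=
    (hP.summable.mul_left (M ^ 2)).of_nonneg_of_le (fun k => by positivity)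
      fun k => mul_le_mul_of_nonneg_right (hμ2 k) (sq_nonneg _)
  have hw0 : ∀ k : d → ℤ, 0 ≤ (if |((k i : ℤ) : ℝ)| < K then (1 : ℝ) else 0) := fun k => by split_ifs <;> norm_num
  have hle : ∀ k, (if |((k i : ℤ) : ℝ)| < K then (1 : ℝ) else 0) * ‖mFourierCoeff (fun x => (θ x : ℂ)) k‖ ^ 2 ≤
      μ k ^ 2 * ‖mFourierCoeff (fun x => (θ x : ℂ)) k‖ ^ 2 := fun k => by
    refine mul_le_mul_of_nonneg_right ?_ (sq_nonneg _)
    split_ifs with h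
    · exact hlow k h
    · exact sq_nonneg _
  exact (hsμ.of_nonneg_of_le (fun k => mul_nonneg (hw0 k) (sq_nonneg _)) hle).tsum_le_tsum hle hsμ

/-- The tracked energy `Σ μ²|𝓕θ|²` is non-negative (termwise); recorded as the non-negativity used by the ledger.
[cite: Grafakos2014, Prop. 3.2.7 (3)] -/
theorem tsum_symbol_sq_nonneg (θ : UnitAddTorus d → ℝ) (μ : (d → ℤ) → ℝ) :
    0 ≤ ∑' k, μ k ^ 2 * ‖mFourierCoeff (fun x => (θ x : ℂ)) k‖ ^ 2 :=
  tsum_nonneg fun k => by positivity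

end LowBlock

/-! ## §4 The stub's conclusion from a ledger -/

/-- **The tracked-symbol ledger gives the stub's conclusion.**  Data: cascade parameters `P`, a rate `r`, a datum `θ₀`
with `‖θ₀‖ > 0`; start-of-phase symbols `μᴴ_j` and mid-phase symbols `μⱽ_j` on `ℤ²` with `|μᴴ| ≤ M`; a start phase `i₀`, a
lag `A ≥ i₀`, a radius scale `c > 0` and growth `ρ ≥ 0` with `μᴴ_J(k)² ≥ 1` whenever `J ≥ i₀` and `|k₀| < cρ^J` (the low
horizontal block at the final phase is untouched by the symbol) and `1 ≤ 8π²κ(cρ^{J})²·tHalf J` at `J = J_r(κ)+A` for every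
`κ > 0` (`…K1Lag.exists_lag`); non-negative per-half-slot errors `εᴴ, εⱽ` (amplitudes) and `ζᴴ, ζⱽ` (energies) with partial sums
from `i₀` bounded by `E` and `Z`; and, for `0 < κ ≤ κ₁` and every classical cascade scalar `w` from `θ₀`:
(start, S-D) `‖μᴴ_{i₀}(D) w(tStart i₀)‖ ≤ q₀`; (H half-slot) `‖μⱽ_j(D) w(tStart j + tHalf j)‖² ≤ (‖μᴴ_j(D) w(tStart j)‖ + εᴴ_j)² + ζᴴ_j`
and (V half-slot) `‖μᴴ_{j+1}(D) w(tStart (j+1))‖² ≤ (‖μⱽ_j(D) w(tStart j + tHalf j)‖ + εⱽ_j)² + ζⱽ_j` for `i₀ ≤ j < J_r(κ)+A`;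
finally the budget `q₀ + E + √Z < ‖θ₀‖_{L²}`.  Then, with `χ = (1 − (q₀+E+√Z)²/‖θ₀‖²)/2 > 0`, the lag `A` and `κ₀ = κ₁`:
for `0 < κ ≤ κ₀` and every classical cascade scalar `w` from `θ₀` there is `K ≥ 0` (namely `cρ^J`) with
`1 ≤ 8π²κK²·tHalf J` and `ofReal(2χ‖θ₀‖²) ≤ highModeEnergy 0 K (w (tStart J)) + 2·eScalarDissipation κ w 0 (tStart J)`,
`J = J_r(κ) + A` — literally the body of `stub_highModeConcentration` when `P = ⟨γ,¼,2,1,ρN⟩`, `r = γ²−3`, `θ₀ = datum`.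
[cite: DEIJ2022, (1.2)–(1.3)] [cite: Grafakos2014, Prop. 3.2.7 (3)] -/
theorem highModeConcentration_of_ledger (P : CascadeParams) (r : ℝ) {θ₀ : UnitAddTorus (Fin 2) → ℝ}
    (hθ₀ : 0 < FluidPDE.Torus.scalarL2Sq θ₀)
    (μH μV : ℕ → (Fin 2 → ℤ) → ℝ) {M : ℝ} (hμH : ∀ j k, |μH j k| ≤ M)
    {i₀ A : ℕ} (hiA : i₀ ≤ A) {c ρ : ℝ} (hc : 0 < c) (hρ : 0 ≤ ρ)
    (hlow : ∀ J, i₀ ≤ J → ∀ k : Fin 2 → ℤ, |((k 0 : ℤ) : ℝ)| < c * ρ ^ J → 1 ≤ μH J k ^ 2)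
    (hlag : ∀ κ : ℝ, 0 < κ → 1 ≤ 8 * Real.pi ^ 2 * κ * (c * ρ ^ (Jrate r κ + A)) ^ 2 * tHalf (Jrate r κ + A))
    {εH εV ζH ζV : ℕ → ℝ} (hεH : ∀ j, 0 ≤ εH j) (hεV : ∀ j, 0 ≤ εV j) (hζH : ∀ j, 0 ≤ ζH j) (hζV : ∀ j, 0 ≤ ζV j)
    {E Z : ℝ} (hE : ∀ n, ∑ j ∈ Finset.Ico i₀ n, (εH j + εV j) ≤ E) (hZ : ∀ n, ∑ j ∈ Finset.Ico i₀ n, (ζH j + ζV j) ≤ Z)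
    {q₀ κ₁ : ℝ} (hq₀ : 0 ≤ q₀) (hκ₁ : 0 < κ₁)
    (hstart : ∀ κ ∈ Ioc (0 : ℝ) κ₁, ∀ w : ℝ → UnitAddTorus (Fin 2) → ℝ,
      FluidPDE.Torus.IsClassicalScalarTransportOn (Ico 0 1) κ P.field w → w 0 = θ₀ →
        Real.sqrt (∑' k, μH i₀ k ^ 2 * ‖mFourierCoeff (fun x => (w (tStart i₀) x : ℂ)) k‖ ^ 2) ≤ q₀)
    (hstepH : ∀ κ ∈ Ioc (0 : ℝ) κ₁, ∀ w : ℝ → UnitAddTorus (Fin 2) → ℝ,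
      FluidPDE.Torus.IsClassicalScalarTransportOn (Ico 0 1) κ P.field w → w 0 = θ₀ →
        ∀ j, i₀ ≤ j → j < Jrate r κ + A →
          ∑' k, μV j k ^ 2 * ‖mFourierCoeff (fun x => (w (tStart j + tHalf j) x : ℂ)) k‖ ^ 2 ≤
            (Real.sqrt (∑' k, μH j k ^ 2 * ‖mFourierCoeff (fun x => (w (tStart j) x : ℂ)) k‖ ^ 2) + εH j) ^ 2 + ζH j)
    (hstepV : ∀ κ ∈ Ioc (0 : ℝ) κ₁, ∀ w : ℝ → UnitAddTorus (Fin 2) → ℝ,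
      FluidPDE.Torus.IsClassicalScalarTransportOn (Ico 0 1) κ P.field w → w 0 = θ₀ →
        ∀ j, i₀ ≤ j → j < Jrate r κ + A →
          ∑' k, μH (j + 1) k ^ 2 * ‖mFourierCoeff (fun x => (w (tStart (j + 1)) x : ℂ)) k‖ ^ 2 ≤
            (Real.sqrt (∑' k, μV j k ^ 2 * ‖mFourierCoeff (fun x => (w (tStart j + tHalf j) x : ℂ)) k‖ ^ 2) + εV j) ^ 2 +
              ζV j)
    (hbudget : q₀ + E + Real.sqrt Z < Real.sqrt (FluidPDE.Torus.scalarL2Sq θ₀)) :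
    ∃ χ : ℝ, 0 < χ ∧ ∃ A' : ℕ, ∃ κ₀ : ℝ, 0 < κ₀ ∧ ∀ κ ∈ Ioc (0 : ℝ) κ₀,
      ∀ w : ℝ → UnitAddTorus (Fin 2) → ℝ,
        FluidPDE.Torus.IsClassicalScalarTransportOn (Ico 0 1) κ P.field w → w 0 = θ₀ →
        ∃ K : ℝ, 0 ≤ K ∧ 1 ≤ 8 * Real.pi ^ 2 * κ * K ^ 2 * tHalf (Jrate r κ + A') ∧
          ENNReal.ofReal (2 * χ * FluidPDE.Torus.scalarL2Sq θ₀) ≤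
            highModeEnergy 0 K (w (tStart (Jrate r κ + A'))) +
              2 * FluidPDE.Torus.eScalarDissipation κ w 0 (tStart (Jrate r κ + A')) := by
  -- the fraction
  set L : ℝ := FluidPDE.Torus.scalarL2Sq θ₀ with hL
  set β : ℝ := q₀ + E + Real.sqrt Z with hβ
  have hE0 : 0 ≤ E := (Finset.sum_nonneg fun j _ => add_nonneg (hεH j) (hεV j)).trans (hE i₀)
  have hZ0 : 0 ≤ Z := (Finset.sum_nonneg fun j _ => add_nonneg (hζH j) (hζV j)).trans (hZ i₀)
  have hβ0 : 0 ≤ β := by positivity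
  have hβL : β ^ 2 < L := by
    have h := pow_lt_pow_left₀ hbudget hβ0 (by norm_num : (2 : ℕ) ≠ 0)
    rwa [Real.sq_sqrt hθ₀.le] at h
  set χ : ℝ := (1 - β ^ 2 / L) / 2 with hχ
  have hχ0 : 0 < χ := by
    rw [hχ]
    have : β ^ 2 / L < 1 := (div_lt_one hθ₀).2 hβL
    linarith
  have hχL : (1 - 2 * χ) * L = β ^ 2 := by
    rw [hχ]; field_simp; ring
  refine ⟨χ, hχ0, A, κ₁, hκ₁, fun κ hκ w hw h0 => ?_⟩
  have hκ0 : 0 < κ := hκ.1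
  set J : ℕ := Jrate r κ + A with hJ
  have hiJ : i₀ ≤ J := hiA.trans (Nat.le_add_left A _)
  refine ⟨c * ρ ^ J, by positivity, hlag κ hκ0, ?_⟩
  -- the tracked amplitudes
  set QH : ℕ → ℝ := fun j => Real.sqrt (∑' k, μH j k ^ 2 * ‖mFourierCoeff (fun x => (w (tStart j) x : ℂ)) k‖ ^ 2)
    with hQH
  set QV : ℕ → ℝ := fun j =>
    Real.sqrt (∑' k, μV j k ^ 2 * ‖mFourierCoeff (fun x => (w (tStart j + tHalf j) x : ℂ)) k‖ ^ 2) with hQV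
  have hQH0 : ∀ j, 0 ≤ QH j := fun j => Real.sqrt_nonneg _
  have hQV0 : ∀ j, 0 ≤ QV j := fun j => Real.sqrt_nonneg _
  have hQH2 : ∀ j, QH j ^ 2 = ∑' k, μH j k ^ 2 * ‖mFourierCoeff (fun x => (w (tStart j) x : ℂ)) k‖ ^ 2 := fun j =>
    Real.sq_sqrt (tsum_symbol_sq_nonneg _ _)
  have hQV2 : ∀ j, QV j ^ 2 = ∑' k, μV j k ^ 2 * ‖mFourierCoeff (fun x => (w (tStart j + tHalf j) x : ℂ)) k‖ ^ 2 :=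
    fun j => Real.sq_sqrt (tsum_symbol_sq_nonneg _ _)
  have hH : ∀ j, i₀ ≤ j → j < J → QV j ^ 2 ≤ (QH j + εH j) ^ 2 + ζH j := fun j hj hjJ => by
    rw [hQV2]; exact hstepH κ hκ w hw h0 j hj hjJ
  have hV : ∀ j, i₀ ≤ j → j < J → QH (j + 1) ^ 2 ≤ (QV j + εV j) ^ 2 + ζV j := fun j hj hjJ => by
    rw [hQH2]; exact hstepV κ hκ w hw h0 j hj hjJ
  have hchain := phase_chain_le hQH0 hQV0 hεH hεV hζH hζV i₀ J hiJ hH hV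
  have hQHJ : QH J ≤ β := by
    calc QH J ≤ QH i₀ + ∑ j ∈ Finset.Ico i₀ J, (εH j + εV j) + Real.sqrt (∑ j ∈ Finset.Ico i₀ J, (ζH j + ζV j)) :=
          hchain
      _ ≤ q₀ + E + Real.sqrt Z := add_le_add (add_le_add (hstart κ hκ w hw h0) (hE J)) (Real.sqrt_le_sqrt (hZ J))
  -- the low block at the final time
  set T : ℝ := tStart J with hT
  have hT0 : 0 ≤ T := tStart_nonneg J
  have hT1 : T < 1 := tStart_lt_one J
  have hwT : Continuous (w T) := (hw.smooth_scalar.isSmooth_slice ⟨hT0, hT1⟩).continuous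
  have hdom := lowModeEnergy_le_of_symbol hwT 0 (c * ρ ^ J) (hμH J) (hlow J hiJ)
  have hle : ∑' k, (if |(((k : Fin 2 → ℤ) 0 : ℤ) : ℝ)| < c * ρ ^ J then (1 : ℝ) else 0) *
        ‖mFourierCoeff (fun x => (w T x : ℂ)) k‖ ^ 2 ≤ (1 - 2 * χ) * FluidPDE.Torus.scalarL2Sq (w 0) := by
    rw [h0, ← hL, hχL]
    refine hdom.trans ?_
    rw [← hQH2 J]
    exact pow_le_pow_left₀ (hQH0 J) hQHJ 2
  have hfin := stub_form_of_lowModeEnergy_le hκ0.le hw hT0 hT1 0 (c * ρ ^ J) hle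
  rwa [h0] at hfin

/-! ## §5 `κ`-uniformity below the threshold phase (tool for the dischargers of the ledger hypotheses) -/

/-- **`κ`-uniformity below the threshold phase.**  For `1 < r`, `0 < κ ≤ 1` and `j < J_r(κ) + A`:
`κ · r^{2j} < r^{2A}` — so any per-phase error of the form `f(κ r^{2j})·g(j)` with `f` monotone is majorised uniformly in `κ`
on the phases the ledger runs over (`J_r(κ) = ⌈log(1/κ)/(2 log r)⌉₊ < log(1/κ)/(2 log r) + 1`).
[cite: ElgindiLissMattingly2025, §1.2.1 and Lemma 2.3 (the |log ν| pulse count)] -/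
theorem mul_pow_lt_pow_of_lt_Jrate_add {r κ : ℝ} (hr : 1 < r) (hκ : 0 < κ) (hκ1 : κ ≤ 1) {j A : ℕ}
    (hj : j < Jrate r κ + A) : κ * r ^ (2 * j) < r ^ (2 * A) := by
  have hr0 : 0 < r := by linarith
  have hlogr : 0 < Real.log r := Real.log_pos hr
  set Lq : ℝ := Real.log (1 / κ) / (2 * Real.log r) with hLq
  have hLq0 : 0 ≤ Lq := by
    rw [hLq]
    exact div_nonneg (Real.log_nonneg (by rw [le_div_iff₀ hκ]; linarith)) (by positivity)
  have hJ0 : (Jrate r κ : ℝ) < Lq + 1 := by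
    unfold Jrate; rw [← hLq]; exact Nat.ceil_lt_add_one hLq0
  -- `j ≤ J_r(κ) + A − 1 < Lq + A`
  have hjR : (j : ℝ) < Lq + A := by
    have h1 : (j : ℝ) + 1 ≤ (Jrate r κ : ℝ) + A := by exact_mod_cast Nat.succ_le_of_lt hj
    linarith
  -- logarithms
  have hlog1 : Real.log (1 / κ) = -Real.log κ := by rw [one_div, Real.log_inv]
  have hkey : Real.log κ + (2 * j : ℝ) * Real.log r < (2 * A : ℝ) * Real.log r := by
    have h2 : (2 * j : ℝ) * Real.log r < 2 * (Lq + A) * Real.log r := by nlinarith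
    have h3 : 2 * Lq * Real.log r = Real.log (1 / κ) := by
      rw [hLq]; field_simp
    nlinarith
  have hlhs : κ * r ^ (2 * j) = Real.exp (Real.log κ + (2 * j : ℝ) * Real.log r) := by
    calc κ * r ^ (2 * j) = Real.exp (Real.log κ) * Real.exp (Real.log (r ^ (2 * j))) := by
          rw [Real.exp_log hκ, Real.exp_log (pow_pos hr0 _)]
      _ = Real.exp (Real.log κ + (2 * j : ℝ) * Real.log r) := by
          rw [← Real.exp_add, Real.log_pow]; push_cast; ring_nf
  have hrhs : r ^ (2 * A) = Real.exp ((2 * A : ℝ) * Real.log r) := by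
    calc r ^ (2 * A) = Real.exp (Real.log (r ^ (2 * A))) := by rw [Real.exp_log (pow_pos hr0 _)]
      _ = Real.exp ((2 * A : ℝ) * Real.log r) := by rw [Real.log_pow]; push_cast; ring_nf
  rw [hlhs, hrhs]
  exact Real.exp_lt_exp.2 hkey

end Summit.AnomalousDissipation.AnomalousDissipation.Theorems.SawtoothPulseCascade.K1Ledger
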